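import Summits.CriticalPhenomena.CardyFormulaZ2.Theorems.CardyComplexConeEdgePrecompactUFRSExteriorWinding
import Summits.CriticalPhenomena.CardyFormulaZ2.Theorems.CardyComplexConeEdgePrecompactUFRSTwoArcExcursion
import Summits.CriticalPhenomena.CardyFormulaZ2.Theorems.CardyComplexConeEdgePrecompactUFRSSimpleLoopWinding

/-!
# The open-arc Hopf formula, I: dart paths, the path functional, and loop excision
(line `qkz-strip-boundary-arm` of crux `CardyComplexCone.EdgePrecompact`, stmt-CriticalPhenomena-11387;
third file of the proof of the OPEN-ARC HOPF FORMULA for the oriented medial graph — the planar input of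
the START-pair residual shared by `ufrs_initialContactCase_certJ` and `ufrs_slippedReturnCase_certJ`)

The OPEN-ARC HOPF FORMULA: for two dart paths `A`, `B` of the oriented medial graph of `ℤ²` (consecutive
`MedialTrail.IsDart` steps, pairwise distinct darts; arbitrary mutual intersections and self-contacts) with the
same first dart `c` and the same last dart `c'`, `(turn sum of A) - (turn sum of B) = 4 · (W (lf c) + W (lf c'))`,
`W` the winding number of the closed chain "darts of `A`, reversed darts of `B`"; equivalently the PATH
FUNCTIONAL `Φ(A) = pturnF A m - 4 · (dwndF A m (lf c) + dwndF A m (lf c'))` depends only on the end darts.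
This file: paths as sequences `A : ℕ → Pt` of length `m` (`pturnF`, `dwndF`), the local geometry of the oriented
medial graph (two darts into / out of one vertex are opposite; the four turns at a double point; the wedge of a
turn with its sign), the tube lemma along a path (`wnd_along_ST`, registered anchor `openArc_tube_ST`), closed
trails given by periodic sequences, and the first reduction `phi_excise_ST`: if the path passes twice through a
vertex at interior indices `1 ≤ i < j ≤ m - 1`, the piece in between is a closed trail `L`, and cutting it out
(`excise A i j`) does not change `Φ` — the turn sum drops by `cturn L + 4ε` (`ε` the entry turn), the winding
sums by `wnd L`, and by the combinatorial Umlaufsatz `MedialTrail.inv_of_isTrail` with the tube lemma along the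
two outer pieces, `wnd L (lf c) = wnd L (lf c') = (σ + ε)/2` where `cturn L = 4σ`.

References: H. Hopf, Compositio Math. 2 (1935), Satz I; S. Smirnov, Ann. of Math. 172 (2010), §4 (oriented medial lattice).
(buildfix 2026-08-20: comment-only re-land to re-enqueue the module build after its blocking imports were repaired; no declaration changed.)
-/
namespace Summit.CriticalPhenomena.CardyFormulaZ2.Cruxes.EdgePrecompact.QkzStripBoundaryArm

open Literature.Probability.LatticeModels Literature.Probability.LatticeModels.MedialTrail
open Literature.Topology.PlaneTopology.RectLoop (cross)
open scoped BigOperators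

/-- The turn sum of the path at its interior points `A 1, …, A (m-1)`. -/
def pturnF (A : ℕ → Pt) (m : ℕ) : ℤ := ∑ k ∈ Finset.range (m - 1), turn (A k) (A (k + 1)) (A (k + 2))

/-- The winding sum of the darts of the path at the face `F`. -/
def dwndF (A : ℕ → Pt) (m : ℕ) (F : Pt) : ℤ := ∑ k ∈ Finset.range m, dartWnd (A k, A (k + 1)) F

/-- The path with the piece between the indices `i` and `j` cut out. -/
def excise (A : ℕ → Pt) (i j : ℕ) : ℕ → Pt := fun k => if k ≤ i then A k else A (k + (j - i))

/-- Two distinct darts out of one vertex are opposite. -/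
theorem out_opposite_ST {v b b' : Pt} (h : IsDart v b) (h' : IsDart v b') (hne : b ≠ b') :
    b'.1 + b.1 = 2 * v.1 ∧ b'.2 + b.2 = 2 * v.2 := by
  obtain ⟨x, y⟩ := v; obtain ⟨p, q⟩ := b; obtain ⟨p', q'⟩ := b'
  simp only [IsDart, ne_eq, Prod.mk.injEq, not_and] at h h' hne ⊢
  omega

/-- Two distinct darts into one vertex are opposite. -/
theorem in_opposite_ST {v a a' : Pt} (h : IsDart a v) (h' : IsDart a' v) (hne : a ≠ a') :
    a'.1 + a.1 = 2 * v.1 ∧ a'.2 + a.2 = 2 * v.2 := by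
  obtain ⟨x, y⟩ := v; obtain ⟨p, q⟩ := a; obtain ⟨p', q'⟩ := a'
  simp only [IsDart, ne_eq, Prod.mk.injEq, not_and] at h h' hne ⊢
  omega

/-- **The four turns at a double point.** Two darts `a → v`, `a' → v` into `v` and two darts `v → b`,
`v → b'` out of `v`, distinct: `turn a v b = turn a' v b' = -turn a v b' = -turn a' v b`. -/
theorem turn_config_ST {a a' v b b' : Pt} (ha : IsDart a v) (ha' : IsDart a' v) (hb : IsDart v b)
    (hb' : IsDart v b') (haa : a ≠ a') (hbb : b ≠ b') :
    turn a' v b' = turn a v b ∧ turn a v b' = -turn a v b ∧ turn a' v b = -turn a v b := by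
  have h1 := in_opposite_ST ha ha' haa
  have h2 := out_opposite_ST hb hb' hbb
  rw [← cross_eq_turn_ST ha.isUnitStep hb.isUnitStep, ← cross_eq_turn_ST ha'.isUnitStep hb'.isUnitStep,
    ← cross_eq_turn_ST ha.isUnitStep hb'.isUnitStep, ← cross_eq_turn_ST ha'.isUnitStep hb.isUnitStep]
  obtain ⟨x, y⟩ := v; obtain ⟨p, q⟩ := a; obtain ⟨p', q'⟩ := a'; obtain ⟨r, s⟩ := b; obtain ⟨r', s'⟩ := b'
  simp only at h1 h2
  obtain ⟨hp, hq⟩ := h1; obtain ⟨hr, hs⟩ := h2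
  have ep : p' = 2 * x - p := by omega
  have eq : q' = 2 * y - q := by omega
  have er : r' = 2 * x - r := by omega
  have es : s' = 2 * y - s := by omega
  subst ep; subst eq; subst er; subst es
  simp only [cross, Prod.fst_sub, Prod.snd_sub]
  refine ⟨by ring, by ring, by ring⟩

/-- Turning a path around negates its turns. -/
theorem turn_rev_ST {a v b : Pt} (h : IsDart a v) (h' : IsDart v b) : turn b v a = -turn a v b := by
  obtain ⟨x, y⟩ := v; obtain ⟨p, q⟩ := a; obtain ⟨p', q'⟩ := b
  simp only [IsDart] at h h'
  simp only [turn]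
  split_ifs <;> omega

/-- **The wedge of a turn, with its sign**: a left turn shares the left face, a right turn the right face. -/
theorem wedge_turn_ST {u v w : Pt} (h1 : IsDart u v) (h2 : IsDart v w) :
    (turn u v w = 1 ∧ lf (u, v) = lf (v, w)) ∨ (turn u v w = -1 ∧ rf (u, v) = rf (v, w)) := by
  obtain ⟨a, b⟩ := u; obtain ⟨c, d⟩ := v; obtain ⟨e, f⟩ := w
  simp only [IsDart] at h1 h2
  rcases h1 with ⟨h0, rfl, rfl | rfl⟩ | ⟨h0, rfl, rfl | rfl⟩ <;>
    rcases h2 with ⟨h0', rfl, rfl | rfl⟩ | ⟨h0', rfl, rfl | rfl⟩ <;> simp [turn] <;> omega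

/-! ## The tube lemma along a path -/

/-- **Tube along a path.** If none of the darts `P t → P (t+1)`, `t < n`, of a dart path is a dart of the
closed walk `l`, the winding number of `l` is the same at the left faces of its first and last darts (and at
the right faces). -/
theorem wnd_along_ST {l : List Pt} (hl : ∀ e ∈ cdarts l, IsDart e.1 e.2) (P : ℕ → Pt) (n : ℕ) (hn : 1 ≤ n)
    (hd : ∀ t < n, IsDart (P t) (P (t + 1))) (hnot : ∀ t < n, (P t, P (t + 1)) ∉ cdarts l) :
    wnd l (lf (P 0, P 1)) = wnd l (lf (P (n - 1), P n)) ∧ wnd l (rf (P 0, P 1)) = wnd l (lf (P (n - 1), P n)) ∧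
      wnd l (rf (P (n - 1), P n)) = wnd l (lf (P (n - 1), P n)) := by
  induction n with
  | zero => omega
  | succ n ih =>
    rcases Nat.eq_zero_or_pos n with rfl | hn'
    · have := wnd_lf_eq_rf hl (d := (P 0, P 1)) (hd 0 (by omega)) (hnot 0 (by omega))
      show wnd l (lf (P 0, P 1)) = wnd l (lf (P 0, P 1)) ∧ wnd l (rf (P 0, P 1)) = wnd l (lf (P 0, P 1)) ∧
        wnd l (rf (P 0, P 1)) = wnd l (lf (P 0, P 1))
      exact ⟨rfl, this.symm, this.symm⟩
    · obtain ⟨e1, e2, e3⟩ := ih hn' (fun t ht => hd t (by omega)) (fun t ht => hnot t (by omega))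
      have key := tube hl (hd (n - 1) (by omega)) (by have := hd n (by omega); rwa [show n - 1 + 1 = n by omega])
        (hnot (n - 1) (by omega)) (by have := hnot n (by omega); rwa [show n - 1 + 1 = n by omega])
      rw [show n + 1 - 1 = n by omega, show n - 1 + 1 = n by omega] at *
      obtain ⟨k1, k2, k3⟩ := key
      refine ⟨?_, ?_, ?_⟩
      · rw [e1, k1, ← k2]
      · rw [e2, k1, ← k2]
      · rw [k3, ← k2]

/-- **Tube along a path** (registered helper `openArc_tube_ST` of stmt-CriticalPhenomena-11387; explicit form of
`wnd_along_ST`). -/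
theorem openArc_tube_ST : ∀ (l : List MedialTrail.Pt) (P : ℕ → MedialTrail.Pt) (n : ℕ), (∀ e ∈ MedialTrail.cdarts l, MedialTrail.IsDart e.1 e.2) → 1 ≤ n → (∀ t < n, MedialTrail.IsDart (P t) (P (t + 1))) → (∀ t < n, (P t, P (t + 1)) ∉ MedialTrail.cdarts l) → MedialTrail.wnd l (MedialTrail.lf (P 0, P 1)) = MedialTrail.wnd l (MedialTrail.lf (P (n - 1), P n)) ∧ MedialTrail.wnd l (MedialTrail.rf (P 0, P 1)) = MedialTrail.wnd l (MedialTrail.lf (P (n - 1), P n)) ∧ MedialTrail.wnd l (MedialTrail.rf (P (n - 1), P n)) = MedialTrail.wnd l (MedialTrail.lf (P (n - 1), P n)) :=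
  fun _ P n hl hn hd hnot => wnd_along_ST hl P n hn hd hnot

/-- A `Q`-periodic sequence of darts, pairwise distinct over one period, is a closed trail. -/
theorem isTrail_of_periodic_ST (P : ℕ → Pt) {Q : ℕ} (hQ : 0 < Q) (hper : P Q = P 0)
    (hd : ∀ k < Q, IsDart (P k) (P (k + 1)))
    (hinj : ∀ k k', k < Q → k' < Q → P k = P k' → P (k + 1) = P (k' + 1) → k = k') :
    IsTrail ((List.range Q).map P) := by
  refine ⟨by simp; omega, ?_, ?_⟩
  · rw [cdarts_map_range P hper]
    refine List.Nodup.map_on ?_ List.nodup_range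
    intro k hk k' hk' h
    rw [List.mem_range] at hk hk'
    simp only [Prod.mk.injEq] at h
    exact hinj k k' hk hk' h.1 h.2
  · rw [cdarts_map_range P hper]
    intro d hd'
    rw [List.mem_map] at hd'
    obtain ⟨k, hk, rfl⟩ := hd'
    exact hd k (List.mem_range.1 hk)

/-- Membership of a dart in the trail of a periodic sequence. -/
theorem mem_cdarts_periodic_ST (P : ℕ → Pt) {Q : ℕ} (hper : P Q = P 0) {d : Pt × Pt} :
    d ∈ cdarts ((List.range Q).map P) ↔ ∃ k < Q, d = (P k, P (k + 1)) := by
  rw [cdarts_map_range P hper, List.mem_map]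
  constructor
  · rintro ⟨k, hk, rfl⟩; exact ⟨k, List.mem_range.1 hk, rfl⟩
  · rintro ⟨k, hk, rfl⟩; exact ⟨k, List.mem_range.2 hk, rfl⟩

/-! ## Loop excision -/

section Excise

variable {A : ℕ → Pt} {m i j : ℕ}

/-- Values of the excised path up to the cut. -/
theorem excise_of_le (A : ℕ → Pt) {i j k : ℕ} (hk : k ≤ i) : excise A i j k = A k := by
  simp [excise, hk]

/-- Values of the excised path after the cut. -/
theorem excise_of_lt (A : ℕ → Pt) {i j k : ℕ} (hk : i < k) : excise A i j k = A (k + (j - i)) := by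
  simp [excise, not_le.2 hk]

/-- The excised path is a dart path (consecutive darts, pairwise distinct) with the same first and last darts. -/
theorem isDartPath_excise_ST (hAd : ∀ k < m, IsDart (A k) (A (k + 1)))
    (hAi : ∀ k k', k < m → k' < m → A k = A k' → A (k + 1) = A (k' + 1) → k = k')
    (hi : 1 ≤ i) (hij : i < j) (hjm : j ≤ m - 1) (heq : A i = A j) :
    ((∀ k < m - (j - i), IsDart (excise A i j k) (excise A i j (k + 1))) ∧
      ∀ k k', k < m - (j - i) → k' < m - (j - i) → excise A i j k = excise A i j k' →
        excise A i j (k + 1) = excise A i j (k' + 1) → k = k') ∧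
    excise A i j 0 = A 0 ∧ excise A i j 1 = A 1 ∧
      excise A i j (m - (j - i) - 1) = A (m - 1) ∧ excise A i j (m - (j - i)) = A m := by
  -- the darts of the excised path are darts of `A`, through the index map `ι`
  set ι : ℕ → ℕ := fun k => if k < i then k else k + (j - i) with hι
  have hval : ∀ k, k < m - (j - i) → (excise A i j k, excise A i j (k + 1)) = (A (ι k), A (ι k + 1)) := by
    intro k hk
    rcases Nat.lt_or_ge k i with h | h
    · rw [excise_of_le A h.le]
      simp only [hι, if_pos h]
      rcases Nat.lt_or_ge (k + 1) (i + 1) with h1 | h1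
      · rw [excise_of_le A (by omega)]
      · omega
    · rcases h.eq_or_lt with rfl | h'
      · rw [excise_of_le A le_rfl, excise_of_lt A (Nat.lt_succ_self _)]
        simp only [hι, lt_irrefl, if_false]
        rw [heq, show i + 1 + (j - i) = j + 1 by omega, show i + (j - i) = j by omega]
      · rw [excise_of_lt A h', excise_of_lt A (by omega)]
        simp only [hι, if_neg (not_lt.2 h)]
        rw [show k + 1 + (j - i) = k + (j - i) + 1 by omega]
  have hιlt : ∀ k, k < m - (j - i) → ι k < m := by
    intro k hk; simp only [hι]; split_ifs <;> omega
  have hιinj : ∀ k k', ι k = ι k' → k = k' := by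
    intro k k' h; simp only [hι] at h; split_ifs at h <;> omega
  refine ⟨⟨fun k hk => ?_, fun k k' hk hk' h1 h2 => ?_⟩, excise_of_le A (Nat.zero_le _), excise_of_le A hi, ?_, ?_⟩
  · have := hval k hk
    rw [Prod.mk.injEq] at this
    rw [this.1, this.2]
    exact hAd _ (hιlt k hk)
  · have e := hval k hk; have e' := hval k' hk'
    rw [Prod.mk.injEq] at e e'
    rw [e.1, e'.1] at h1; rw [e.2, e'.2] at h2
    exact hιinj k k' (hAi _ _ (hιlt k hk) (hιlt k' hk') h1 h2)
  · by_cases h : i < m - (j - i) - 1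
    · rw [excise_of_lt A h]; congr 1; omega
    · have e : m - (j - i) - 1 = i := by omega
      rw [e, excise_of_le A le_rfl, heq]; congr 1; omega
  · rw [excise_of_lt A (by omega)]; congr 1; omega

/-- The turn sum of the excised path: it drops by the entry turn, the turns inside the loop, and the exit
turn, and gains the new turn at the cut. -/
theorem pturnF_excise_ST (hi : 1 ≤ i) (hij : i < j) (hm : j + 1 ≤ m) (heq : A i = A j) :
    pturnF A m - pturnF (excise A i j) (m - (j - i)) =
      turn (A (i - 1)) (A i) (A (i + 1)) + ∑ k ∈ Finset.range (j - i - 1), turn (A (i + k)) (A (i + k + 1)) (A (i + k + 2)) +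
        turn (A (j - 1)) (A j) (A (j + 1)) - turn (A (i - 1)) (A i) (A (j + 1)) := by
  unfold pturnF
  set f : ℕ → ℤ := fun k => turn (A k) (A (k + 1)) (A (k + 2)) with hf
  set g : ℕ → ℤ := fun k => turn (excise A i j k) (excise A i j (k + 1)) (excise A i j (k + 2)) with hg
  -- split the sum of `f` at `i - 1`, `i`, `j - 1`, `j`
  have hA : ∑ k ∈ Finset.range (m - 1), f k = ∑ k ∈ Finset.range (i - 1), f k + f (i - 1) +
      ∑ k ∈ Finset.range (j - i - 1), f (i + k) + f (j - 1) + ∑ k ∈ Finset.range (m - 1 - j), f (j + k) := by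
    rw [show Finset.range (m - 1) = Finset.range ((i - 1) + (1 + ((j - i - 1) + (1 + (m - 1 - j))))) from by congr 1; omega,
      Finset.sum_range_add, Finset.sum_range_add, Finset.sum_range_one, Finset.sum_range_add, Finset.sum_range_add,
      Finset.sum_range_one]
    have e1 : ∑ x ∈ Finset.range (j - i - 1), f (i - 1 + (1 + x)) = ∑ x ∈ Finset.range (j - i - 1), f (i + x) :=
      Finset.sum_congr rfl fun x _ => by rw [show i - 1 + (1 + x) = i + x by omega]
    have e2 : ∑ x ∈ Finset.range (m - 1 - j), f (i - 1 + (1 + (j - i - 1 + (1 + x)))) = ∑ x ∈ Finset.range (m - 1 - j), f (j + x) :=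
      Finset.sum_congr rfl fun x _ => by rw [show i - 1 + (1 + (j - i - 1 + (1 + x))) = j + x by omega]
    rw [e1, e2, show i - 1 + 0 = i - 1 by omega, show i - 1 + (1 + (j - i - 1 + 0)) = j - 1 by omega]
    ring
  -- split the sum of `g` at `i - 1`, `i`
  have hE : ∑ k ∈ Finset.range (m - (j - i) - 1), g k =
      ∑ x ∈ Finset.range (i - 1), f x + (g (i - 1) + ∑ x ∈ Finset.range (m - 1 - j), f (j + x)) := by
    rw [show Finset.range (m - (j - i) - 1) = Finset.range ((i - 1) + (1 + (m - 1 - j))) from by congr 1; omega,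
      Finset.sum_range_add, Finset.sum_range_add, Finset.sum_range_one, show i - 1 + 0 = i - 1 by omega]
    have e1 : ∑ x ∈ Finset.range (i - 1), g x = ∑ x ∈ Finset.range (i - 1), f x := by
      refine Finset.sum_congr rfl fun x hx => ?_
      rw [Finset.mem_range] at hx
      simp only [hf, hg, excise_of_le A (show x ≤ i by omega), excise_of_le A (show x + 1 ≤ i by omega),
        excise_of_le A (show x + 2 ≤ i by omega)]
    have e2 : ∑ x ∈ Finset.range (m - 1 - j), g (i - 1 + (1 + x)) = ∑ x ∈ Finset.range (m - 1 - j), f (j + x) := by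
      refine Finset.sum_congr rfl fun x hx => ?_
      rw [show i - 1 + (1 + x) = i + x by omega]
      simp only [hf, hg]
      rcases Nat.eq_zero_or_pos x with rfl | hx0
      · rw [add_zero, add_zero, excise_of_le A le_rfl, excise_of_lt A (by omega), excise_of_lt A (by omega), heq,
          show i + 1 + (j - i) = j + 1 by omega, show i + 2 + (j - i) = j + 2 by omega]
      · rw [excise_of_lt A (by omega), excise_of_lt A (by omega), excise_of_lt A (by omega),
          show i + x + (j - i) = j + x by omega, show i + x + 1 + (j - i) = j + x + 1 by omega,
          show i + x + 2 + (j - i) = j + x + 2 by omega]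
    rw [e1, e2]
  have hg' : g (i - 1) = turn (A (i - 1)) (A i) (A (j + 1)) := by
    simp only [hg]
    rw [excise_of_le A (Nat.sub_le _ _), show i - 1 + 1 = i by omega, excise_of_le A le_rfl,
      show i - 1 + 2 = i + 1 by omega, excise_of_lt A (Nat.lt_succ_self _), show i + 1 + (j - i) = j + 1 by omega]
  rw [hA, hE, hg']
  simp only [hf, show i - 1 + 1 = i by omega, show i - 1 + 2 = i + 1 by omega, show j - 1 + 1 = j by omega,
    show j - 1 + 2 = j + 1 by omega]
  ring

/-- The winding sum of the excised path: it drops by the winding sum of the loop. -/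
theorem dwndF_excise_ST (hi : 1 ≤ i) (hij : i < j) (hm : j ≤ m) (heq : A i = A j) (F : Pt) :
    dwndF A m F - dwndF (excise A i j) (m - (j - i)) F = ∑ k ∈ Finset.range (j - i), dartWnd (A (i + k), A (i + k + 1)) F := by
  unfold dwndF
  set w : ℕ → ℤ := fun k => dartWnd (A k, A (k + 1)) F with hw
  have hA : ∑ k ∈ Finset.range m, w k = ∑ k ∈ Finset.range i, w k + ∑ k ∈ Finset.range (j - i), w (i + k) +
      ∑ k ∈ Finset.range (m - j), w (j + k) := by
    rw [show Finset.range m = Finset.range (i + ((j - i) + (m - j))) from by congr 1; omega, Finset.sum_range_add,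
      Finset.sum_range_add]
    have e : ∑ x ∈ Finset.range (m - j), w (i + (j - i + x)) = ∑ x ∈ Finset.range (m - j), w (j + x) :=
      Finset.sum_congr rfl fun x _ => by rw [show i + (j - i + x) = j + x by omega]
    rw [e]; ring
  have hE : ∑ k ∈ Finset.range (m - (j - i)), dartWnd (excise A i j k, excise A i j (k + 1)) F =
      ∑ k ∈ Finset.range i, w k + ∑ k ∈ Finset.range (m - j), w (j + k) := by
    rw [show Finset.range (m - (j - i)) = Finset.range (i + (m - j)) from by congr 1; omega, Finset.sum_range_add]
    congr 1
    · refine Finset.sum_congr rfl fun k hk => ?_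
      rw [Finset.mem_range] at hk
      rw [excise_of_le A hk.le, excise_of_le A (by omega)]
    · refine Finset.sum_congr rfl fun k hk => ?_
      rcases Nat.eq_zero_or_pos k with rfl | hk0
      · rw [add_zero, excise_of_le A le_rfl, excise_of_lt A (by omega), heq, show i + 1 + (j - i) = j + 1 by omega,
          add_zero]
      · rw [excise_of_lt A (by omega), excise_of_lt A (by omega), show i + k + (j - i) = j + k by omega,
          show i + k + 1 + (j - i) = j + k + 1 by omega]
  rw [hA, hE]
  ring

/-- **Loop excision does not change the path functional** (the first reduction of the open-arc formula). DATA: a dart path `A 0, …, A m` (consecutive darts, pairwise distinct) passing twice through one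
vertex at interior indices, `A i = A j`, `1 ≤ i < j ≤ m - 1`. CONCLUSION: with `F₁ = lf (A 0, A 1)`,
`F₂ = lf (A (m-1), A m)`, the functional `pturnF - 4 (dwndF F₁ + dwndF F₂)` of `A` equals that of `excise A i j`.
See the module docstring for the proof. -/
theorem phi_excise_ST (hAd : ∀ k < m, IsDart (A k) (A (k + 1)))
    (hAi : ∀ k k', k < m → k' < m → A k = A k' → A (k + 1) = A (k' + 1) → k = k')
    (hi : 1 ≤ i) (hij : i < j) (hjm : j + 1 ≤ m) (heq : A i = A j) :
    pturnF A m - 4 * (dwndF A m (lf (A 0, A 1)) + dwndF A m (lf (A (m - 1), A m))) =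
      pturnF (excise A i j) (m - (j - i)) -
        4 * (dwndF (excise A i j) (m - (j - i)) (lf (A 0, A 1)) + dwndF (excise A i j) (m - (j - i)) (lf (A (m - 1), A m))) := by
  -- the loop as a periodic sequence
  set Q := j - i with hQ
  have hQpos : 0 < Q := by omega
  set P : ℕ → Pt := fun k => A (i + k % Q) with hP
  have hPlt : ∀ k < Q, P k = A (i + k) := fun k hk => by simp only [hP, Nat.mod_eq_of_lt hk]
  have hPQ : P Q = A i := by simp only [hP, Nat.mod_self, add_zero]
  have hP0 : P 0 = A i := by simp only [hP, Nat.zero_mod, add_zero]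
  have hper : P Q = P 0 := by rw [hPQ, hP0]
  have hPd : ∀ k < Q, (P k, P (k + 1)) = (A (i + k), A (i + k + 1)) := by
    intro k hk
    rw [hPlt k hk]
    rcases Nat.lt_or_ge (k + 1) Q with h | h
    · rw [hPlt (k + 1) h, add_assoc]
    · rw [show k + 1 = Q by omega, hPQ, heq, show j = i + k + 1 by omega]
  have hT : IsTrail ((List.range Q).map P) := by
    refine isTrail_of_periodic_ST P hQpos hper (fun k hk => ?_) (fun k k' hk hk' h1 h2 => ?_)
    · have e := hPd k hk; rw [Prod.mk.injEq] at e; rw [e.1, e.2]; exact hAd _ (by omega)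
    · have e := hPd k hk; have e' := hPd k' hk'
      rw [Prod.mk.injEq] at e e'
      rw [e.1, e'.1] at h1; rw [e.2, e'.2] at h2
      have := hAi _ _ (by omega) (by omega) h1 h2; omega
  have h4 := hT.four_le_length
  simp only [List.length_map, List.length_range] at h4
  have hper' : P (Q + 1) = P 1 := by simp only [hP]; rw [Nat.add_mod_left, Nat.mod_eq_of_lt (by omega : 1 < Q)]
  have hmem : ∀ d, d ∈ cdarts ((List.range Q).map P) ↔ ∃ k < Q, d = (A (i + k), A (i + k + 1)) := by
    intro d
    rw [mem_cdarts_periodic_ST P hper]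
    constructor
    · rintro ⟨k, hk, rfl⟩; exact ⟨k, hk, hPd k hk⟩
    · rintro ⟨k, hk, rfl⟩; exact ⟨k, hk, (hPd k hk).symm⟩
  -- turning and winding of the loop
  have hct : cturn ((List.range Q).map P) = ∑ k ∈ Finset.range (Q - 1), turn (A (i + k)) (A (i + k + 1)) (A (i + k + 2)) +
      turn (A (j - 1)) (A i) (A (i + 1)) := by
    rw [cturn_map_range P (by omega) hper hper', show Finset.range Q = Finset.range ((Q - 1) + 1) by congr 1; omega,
      Finset.sum_range_succ]
    congr 1
    · refine Finset.sum_congr rfl fun k hk => ?_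
      rw [Finset.mem_range] at hk
      rw [hPlt k (by omega), hPlt (k + 1) (by omega), add_assoc]
      rcases Nat.lt_or_ge (k + 2) Q with h | h
      · rw [hPlt (k + 2) h, add_assoc]
      · rw [show k + 2 = Q by omega, hPQ, heq, show i + k + 2 = j by omega]
    · rw [hPlt (Q - 1) (by omega), show Q - 1 + 1 = Q by omega, hPQ, show Q - 1 + 2 = Q + 1 by omega, hper',
        hPlt 1 (by omega), show i + (Q - 1) = j - 1 by omega]
  have hw : ∀ F, wnd ((List.range Q).map P) F = ∑ k ∈ Finset.range Q, dartWnd (A (i + k), A (i + k + 1)) F := by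
    intro F
    rw [wnd_map_range_SR P hper F]
    exact Finset.sum_congr rfl fun k hk => by rw [hPd k (Finset.mem_range.1 hk)]
  -- the four turns at the double point
  have hi1 : i - 1 + 1 = i := by omega
  have hda : IsDart (A (i - 1)) (A i) := by have := hAd (i - 1) (by omega); rwa [hi1] at this
  have hda' : IsDart (A (j - 1)) (A i) := by have := hAd (j - 1) (by omega); rwa [show j - 1 + 1 = j by omega, ← heq] at this
  have hdb : IsDart (A i) (A (i + 1)) := hAd i (by omega)
  have hdb' : IsDart (A i) (A (j + 1)) := by have := hAd j (by omega); rwa [← heq] at this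
  have haa : A (i - 1) ≠ A (j - 1) := by
    intro h
    have := hAi (i - 1) (j - 1) (by omega) (by omega) h (by rw [hi1, show j - 1 + 1 = j by omega, heq]); omega
  have hbb : A (i + 1) ≠ A (j + 1) := by
    intro h; have := hAi i j (by omega) (by omega) heq h; omega
  obtain ⟨cexit, cnew, cclose⟩ := turn_config_ST hda hda' hdb hdb' haa hbb
  -- the functional
  have hT1 := pturnF_excise_ST hi hij hjm heq
  rw [← heq] at hT1
  have hW1 := dwndF_excise_ST (m := m) hi hij (by omega) heq (lf (A 0, A 1))
  have hW2 := dwndF_excise_ST (m := m) hi hij (by omega) heq (lf (A (m - 1), A m))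
  rw [← hw] at hW1 hW2
  rw [← hQ] at hT1 hW1 hW2
  -- `in1 = (A (i-1), A i)` and `out2 = (A i, A (j+1))` are not darts of the loop; `out1`, `in2` are
  have hdl : ∀ e ∈ cdarts ((List.range Q).map P), IsDart e.1 e.2 := hT.2.2
  have hout1 : (A i, A (i + 1)) ∈ cdarts ((List.range Q).map P) := (hmem _).2 ⟨0, hQpos, by simp⟩
  have hin2 : (A (j - 1), A i) ∈ cdarts ((List.range Q).map P) :=
    (hmem _).2 ⟨Q - 1, by omega, by rw [show i + (Q - 1) = j - 1 by omega, show j - 1 + 1 = j by omega, heq]⟩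
  have hnotin : ∀ t, t < i ∨ j ≤ t → t < m → (A t, A (t + 1)) ∉ cdarts ((List.range Q).map P) := by
    intro t ht htm hmem'
    obtain ⟨k, hk, e⟩ := (hmem _).1 hmem'
    rw [Prod.mk.injEq] at e
    have := hAi t (i + k) htm (by omega) e.1 e.2
    omega
  -- transport to the two ends
  obtain ⟨tr1, -, -⟩ := wnd_along_ST hdl A i hi (fun t ht => hAd t (by omega)) (fun t ht => hnotin t (Or.inl ht) (by omega))
  obtain ⟨tr2, -, -⟩ := wnd_along_ST hdl (fun t => A (j + t)) (m - j) (by omega) (fun t ht => hAd (j + t) (by omega))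
    (fun t ht => hnotin (j + t) (Or.inr (by omega)) (by omega))
  simp only [add_zero, show j + (m - j - 1) = m - 1 by omega, show j + (m - j) = m by omega] at tr2
  rw [← heq] at tr2
  have ω1 := wnd_lf_eq_rf hdl hda (by have := hnotin (i - 1) (Or.inl (by omega)) (by omega); rwa [hi1] at this)
  have ω2 := wnd_lf_eq_rf hdl hdb' (by have := hnotin j (Or.inr le_rfl) (by omega); rwa [← heq] at this)
  -- the case analysis: orientation of the loop and sign of the entry turn
  have hlf2 := hT.wnd_lf hin2
  rcases (inv_of_isTrail _ hT).rf_cases hT hout1 with ⟨r1, l1, c4, hv⟩ | ⟨r1, l1, c4, hv⟩ <;>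
    rcases wedge_turn_ST hda hdb with ⟨ε1, w1⟩ | ⟨ε1, w1⟩ <;>
    rcases wedge_turn_ST hda' hdb' with ⟨ε2, w2⟩ | ⟨ε2, w2⟩ <;>
    · have h1 := hv (rf (A (j - 1), A i)); have h2 := hv (lf (A (j - 1), A i))
      rw [cexit] at ε2
      rw [hct] at c4
      first
      | (exfalso; omega)
      | (rw [w1] at tr1; rw [← w2] at tr2; omega)
      | (rw [ω1, w1] at tr1; rw [ω2, ← w2] at tr2; omega)

end Excise

end Summit.CriticalPhenomena.CardyFormulaZ2.Cruxes.EdgePrecompact.QkzStripBoundaryArm
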